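import Literature.AnabelianGeometry.EtaleTheta.Discharge.Sec1Thm110MatchingReflNV
import Literature.AnabelianGeometry.EtaleTheta.ThetaLiftUnique
import HarnessLib

/-!
# [EtTh] Thm. 1.10 (ii): «THE isomorphism `K^×_α ⥲ K^×_β` induced by `γ`» is well defined
# (K2 bookkeeping for the named input `Thm110DeltaInduced`; abc-iut-w5-d140)

[EtTh] Thm. 1.10 (ii) p.256 [cite: MochizukiEtTh2009, Thm 1.10 (ii) p.30]: «The isomorphism `K^×_α →̃ K^×_β` …
induced by `γ`».  PROOF-ONLY.  The K2 routes (p428966/p429307/p430193) take `Thm110DeltaInduced H δ` — "`δ` IS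
induced by `γ` on the Kummer classes of constants" (this seat's gen-0 `ConstantMultipleRigiditySub`, p417168) —
as a named input.  This file records that the definite article is justified and calibrates the input at the
identity: `δ` is UNIQUE (the constant classes `infl κ̈(a)` are injective in `a`: `toKddHat`, `kumYdd` and
abc-iut-L2-t12's `inflTheta_injective`), and at `γ = id` the only induced `δ` is the identity.  Nothing of
[EtTh] is asserted; no side taken on [IUTchIII] Cor. 3.12.
-/

noncomputable section

namespace Literature.AnabelianGeometry.EtaleTheta

open Literature.AnabelianGeometry.SemiGraphs

variable {p : ℕ} [Fact p.Prime]

section Thm110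

variable {Mα Mβ : MuTwoSetting p} {εα : Mα.GtpC} {εβ : Mβ.GtpC} {hCα : Mα.toThetaSetting.Compat}
  {hCβ : Mβ.toThetaSetting.Compat} {Eα : Mα.toThetaSetting.EtaleThetaData}
  {Eβ : Mβ.toThetaSetting.EtaleThetaData} {γ : Mα.dotC εα ≃ₜ* Mβ.dotC εβ}

/-- The constant classes `a ↦ infl κ̈(a) ∈ H¹(Π^tp_Ÿ, Δ_Θ)` are injective in `a ∈ K̈^×` (`toKddHat`, `kumYdd`
injective by the interface; inflation injective, abc-iut-L2-t12). [cite: MochizukiEtTh2009, Prop 1.5 (ii) p.23] -/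
theorem MuTwoSetting.inflTheta_kumYdd_toKddHat_injective (M : MuTwoSetting p)
    (E : M.toThetaSetting.KummerData) :
    Function.Injective fun a : (↥M.Kdd)ˣ =>
      M.toThetaSetting.inflTheta M.toThetaSetting.GtpYdd (E.kumYdd (E.toKddHat a)) :=
  fun _ _ h => E.toKddHat_injective (E.kumYdd_injective (M.toThetaSetting.inflTheta_injective _ h))

/-- **`δ` is unique**: two isomorphisms `K̈^×_α ≃ K̈^×_β` both induced by `γ` on the Kummer classes of
constants coincide — «THE isomorphism induced by `γ`» (Thm. 1.10 (ii)). [cite: MochizukiEtTh2009, Thm 1.10 (ii) p.30] -/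
theorem Thm110DeltaInduced.unique {H : Thm110Hypothesis εα εβ hCα hCβ Eα Eβ γ}
    {δ δ' : (↥Mα.Kdd)ˣ ≃* (↥Mβ.Kdd)ˣ} (hδ : Thm110DeltaInduced H δ) (hδ' : Thm110DeltaInduced H δ') :
    δ = δ' := by
  refine MulEquiv.ext fun a => ?_
  exact Mβ.inflTheta_kumYdd_toKddHat_injective Eβ.toKummerData ((hδ a).symm.trans (hδ' a))

/-- **Calibration at the identity**: for a `Thm110Hypothesis` over `γ = id` whose `γ_X` is the identity
(e.g. the identity witness of `thm110i_inputs_refl`, p429827), the induced `δ` is the identity of `K̈^×`.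
[cite: MochizukiEtTh2009, Thm 1.10 (ii) p.30] -/
theorem Thm110DeltaInduced.eq_refl_of_γX_refl {M : MuTwoSetting p} {εZ : M.GtpC}
    {hC : M.toThetaSetting.Compat} {E : M.toThetaSetting.EtaleThetaData}
    {H : Thm110Hypothesis εZ εZ hC hC E E (ContinuousMulEquiv.refl (M.dotC εZ))}
    (hX : H.γX = ContinuousMulEquiv.refl M.PiTemp)
    {δ : (↥M.Kdd)ˣ ≃* (↥M.Kdd)ˣ} (hδ : Thm110DeltaInduced H δ) : δ = MulEquiv.refl _ := by
  refine MulEquiv.ext fun a => ?_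
  apply M.inflTheta_kumYdd_toKddHat_injective E.toKummerData
  change M.toThetaSetting.inflTheta M.toThetaSetting.GtpYdd (E.kumYdd (E.toKddHat (δ a))) =
    M.toThetaSetting.inflTheta M.toThetaSetting.GtpYdd (E.kumYdd (E.toKddHat a))
  rw [← hδ a]
  -- transport along `(γ_X, companion)` with `γ_X = id` is the identity (`transport_refl`)
  obtain ⟨admα, admβ, Γ, preserves, restricts, γX, γX_spec, thm16i, companion, maps_orbit⟩ := H
  dsimp only at hX
  subst hX
  exact ThetaSetting.transport_refl _ _ _

end Thm110

end Literature.AnabelianGeometry.EtaleTheta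

end
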